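import Literature.MathematicalPhysics.KineticTheory.CollisionTubePullbackPair
import HarnessLib

/-!
# The collision-cylinder pull-back along hard-sphere orbits, VI: assembly over the pairs

Summing the pair inequality over the ordered pairs: the collision side re-indexes to the collision pair
sum, the pre-empted stretches are charged to the pre-empting collision (three-body count at a collision,
`sum_sum_ite_participates_le`), the late ones to the shell count at time `τ`, giving
`|collisionSum − ∫₀^τ tubeStat … 1 κ t (Φ_t z) dt| ≤ ((N+1)κ)⁻¹ collisionMismatch
+ C_χ C_g C_Ψ · ε/(N+1) · (2 threeBodyCollisionSum + pairShellCount (Φ_τ z))`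
(`collisionSum_sub_integral_tubeStat_le`).

## References

* C. Cercignani, R. Illner, M. Pulvirenti, *The Mathematical Theory of Dilute Gases* (1994), §2.2
  (Boltzmann's collision cylinder: the molecules about to hit a given one within time `dt` fill the
  cylinder of height `|V · n| dt` over the protection sphere; pre-collisional hemisphere `V · n < 0`).
  [CIPDiluteGases1994]
* I. Gallagher, L. Saint-Raymond, B. Texier, *From Newton to Boltzmann* (2013), Part II Ch. 4, §4.1
  (the hard-sphere flow: free flow between collisions, elastic reflection at `|xᵢ − xⱼ| = ε`,
  pre-collisional iff `νⁱʲ · (vᵢ − vⱼ) < 0`; Prop. 4.1.1, Def. 4.1.2). [GallagherSaintRaymondTexier2013]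
-/

noncomputable section

open scoped BigOperators Classical InnerProductSpace ENNReal Topology
open Set MeasureTheory Filter Function
open Literature.Analysis.FluidPDE

namespace Literature.MathematicalPhysics.KineticTheory

/-! ## Assembly: the pathwise cylinder pull-back -/

section Assembly

variable {σ : ℝ} {N : ℕ} {Φ : HardSphereFlow (Torus.geometry (Fin 3)) (hsDiameter σ N) (N + 1)}
  {z : Config (N + 1) (Fin 3) T3} {χ : ℝ × UnitAddTorus (Fin 3) → ℝ} {g : ℝ → ℝ}
  {Ψ : V3 × V3 × V3 → ℝ} {r κ L τ Cχ Cg CΨ : ℝ}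

/-- A sum over the ordered contact pairs is a double sum with the membership indicator. [folklore] -/
theorem sum_contactPairs_eq_sum_sum_ite (ζ : Config (N + 1) (Fin 3) T3) (f : Fin (N + 1) × Fin (N + 1) → ℝ) :
    ∑ p ∈ contactPairs (Torus.geometry (Fin 3)) (hsDiameter σ N) ζ, f p =
      ∑ i, ∑ j, if (i, j) ∈ contactPairs (Torus.geometry (Fin 3)) (hsDiameter σ N) ζ then f (i, j) else 0 := by
  rw [← Finset.sum_product' Finset.univ Finset.univ
    (fun i j => if (i, j) ∈ contactPairs (Torus.geometry (Fin 3)) (hsDiameter σ N) ζ then f (i, j) else 0)]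
  rw [← Finset.sum_filter]
  congr 1
  ext p
  simp

/-- **Three-body count at a collision.**  At a collision time `b` (pair `{p, q}`), the number of
ordered pairs `(i, j)` touching the collision (`i` or `j` participates) and sitting in the
near-contact shell is at most twice the number of shell neighbours of the two partners. [folklore] -/
theorem sum_sum_ite_participates_le (hz : z ∈ Φ.good) (hε2 : hsDiameter σ N < 2⁻¹) {b : ℝ}
    (hb : b ∈ collisionTimes (Torus.geometry (Fin 3)) (hsDiameter σ N) (orbit σ N Φ z)) :
    ∑ i : Fin (N + 1), ∑ j : Fin (N + 1),
        (if Participates (Torus.geometry (Fin 3)) (hsDiameter σ N) (orbit σ N Φ z b) i ∨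
            Participates (Torus.geometry (Fin 3)) (hsDiameter σ N) (orbit σ N Φ z b) j then
          shellInd σ N L κ (orbit σ N Φ z b) i j else 0) ≤
      2 * ∑ e ∈ contactPairs (Torus.geometry (Fin 3)) (hsDiameter σ N) (orbit σ N Φ z b),
        shellCount σ N L κ (orbit σ N Φ z b) e.1 := by
  obtain ⟨⟨p, q⟩, hpq⟩ := mem_collisionTimes_iff_contactPairs_nonempty.1 hb
  have hne : p ≠ q := (mem_contactPairs.1 hpq).1
  have hreg := Torus.isHardSphereRegular_geometry (d := Fin 3) hε2
  have hpair := (isTraj hz).contactPairs_eq_pair hreg hpq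
  have hpart : ∀ k, Participates (Torus.geometry (Fin 3)) (hsDiameter σ N) (orbit σ N Φ z b) k ↔ k = p ∨ k = q :=
    fun k => (isTraj hz).participates_iff hpq
  set ζ := orbit σ N Φ z b with hζ
  -- split the disjunction
  have hsplit : ∀ i j : Fin (N + 1),
      (if (i = p ∨ i = q) ∨ (j = p ∨ j = q) then shellInd σ N L κ ζ i j else 0) ≤
        (if i = p ∨ i = q then shellInd σ N L κ ζ i j else 0) +
          (if j = p ∨ j = q then shellInd σ N L κ ζ i j else 0) := by
    intro i j
    have h0 := shellInd_nonneg (σ := σ) L κ ζ i j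
    split_ifs <;> first | linarith | tauto
  have hkey : ∀ f : Fin (N + 1) → ℝ, ∑ k, (if k = p ∨ k = q then f k else 0) = f p + f q := by
    intro f
    rw [← Finset.sum_filter]
    have : Finset.univ.filter (fun k : Fin (N + 1) => k = p ∨ k = q) = {p, q} := by
      ext k; simp
    rw [this, Finset.sum_pair hne]
  simp only [hpart]
  calc ∑ i, ∑ j, (if (i = p ∨ i = q) ∨ (j = p ∨ j = q) then shellInd σ N L κ ζ i j else 0)
      ≤ ∑ i, ∑ j, ((if i = p ∨ i = q then shellInd σ N L κ ζ i j else 0) +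
          (if j = p ∨ j = q then shellInd σ N L κ ζ i j else 0)) :=
        Finset.sum_le_sum fun i _ => Finset.sum_le_sum fun j _ => hsplit i j
    _ = ∑ i, (if i = p ∨ i = q then shellCount σ N L κ ζ i else 0) +
          ∑ j, (if j = p ∨ j = q then shellCount σ N L κ ζ j else 0) := by
        simp only [Finset.sum_add_distrib]
        congr 1
        · refine Finset.sum_congr rfl fun i _ => ?_
          split_ifs
          · rfl
          · simp
        · rw [Finset.sum_comm]
          refine Finset.sum_congr rfl fun j _ => ?_
          split_ifs
          · unfold shellCount
            exact Finset.sum_congr rfl fun i _ => shellInd_comm L κ ζ i j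
          · simp
    _ = 2 * (shellCount σ N L κ ζ p + shellCount σ N L κ ζ q) := by rw [hkey]; ring
    _ = 2 * ∑ e ∈ contactPairs (Torus.geometry (Fin 3)) (hsDiameter σ N) ζ, shellCount σ N L κ ζ e.1 := by
        rw [hpair, Finset.sum_pair]
        intro h
        exact hne (Prod.mk.inj h).1

/-- **The time integral of the tube functional is the weighted sum of the pair integrals.**
[folklore] -/
theorem setIntegral_tubeStat_orbit_eq (hz : z ∈ Φ.good) (hχ : Continuous χ) (hg : Continuous g)
    (hΨc : Continuous Ψ) (hχb : ∀ t ∈ Icc (0 : ℝ) τ, ∀ x, |χ (t, x)| ≤ Cχ)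
    (hgb : ∀ a, 0 ≤ a → |g a| ≤ Cg) (hΨb : ∀ p, |Ψ p| ≤ CΨ) (hσ : 0 ≤ σ) (hr : 0 < r) (ϑ : ℝ) :
    ∫ t in Icc 0 τ, tubeStat σ N χ g Ψ r ϑ 1 κ t (Φ.flow t z) =
      ((N + 1 : ℝ) * κ)⁻¹ * ∑ i : Fin (N + 1), ∑ j : Fin (N + 1),
        ∫ t in Icc 0 τ, tubeTerm σ N χ g Ψ r κ t (orbit σ N Φ z t) i j := by
  have hint := fun i j => integrableOn_tubeTerm_orbit (κ := κ) (τ := τ) hz hχ hg hΨc hχb hgb hΨb hσ hr i j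
  show ∫ t in Icc 0 τ, tubeStat σ N χ g Ψ r ϑ 1 κ t (orbit σ N Φ z t) = _
  simp_rw [tubeStat_one_eq]
  rw [integral_const_mul, integral_finsetSum _ fun i _ => integrable_finsetSum _ fun j _ => hint i j]
  congr 1
  refine Finset.sum_congr rfl fun i _ => ?_
  rw [integral_finsetSum _ fun j _ => hint i j]

/-- **The pull-back assembled over the pairs.**  Along the orbit of a good initial datum `z` of a
hard-sphere flow `Φ` on `𝕋³` (`N + 1` spheres of diameter `ε = hsDiameter σ N`), for continuous
bounded marks `χ, g, Ψ` with `Ψ(n, v, w) = 0` whenever `‖w − v‖ ≥ 2L`, flight-time parameter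
`κ > 0` with `ε (1 + 2 L κ) < 1/2`:
`|K_N[χ g Ψ](z) − ∫₀^τ A_t(Φ_t z) dt| ≤ ((N+1)κ)⁻¹ R₁(z) + C_χ C_g C_Ψ · ε/(N+1) · (2 N₃(z) + P(Φ_τ z))`,
where `A_t = tubeStat σ N χ g Ψ r ϑ 1 κ t` is the fixed-time tube functional at truncation level `1`,
`R₁ = collisionMismatch` (short flights, early boundary, continuity correction — exact),
`N₃ = threeBodyCollisionSum` (pre-empted tube pairs, charged to the pre-empting collision) and
`P = pairShellCount` (tube pairs whose predicted collision lies beyond `τ`). [folklore] -/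
theorem collisionSum_sub_integral_tubeStat_le (hz : z ∈ Φ.good) (hσ : 0 < σ) (hκ : 0 < κ) (hL : 0 ≤ L)
    (hsmall : hsDiameter σ N * (1 + 2 * L * κ) < 1 / 2) (hτ : 0 < τ) (hr : 0 < r)
    (hχ : Continuous χ) (hg : Continuous g) (hΨc : Continuous Ψ)
    (hχb : ∀ t ∈ Icc (0 : ℝ) τ, ∀ x, |χ (t, x)| ≤ Cχ) (hgb : ∀ a, 0 ≤ a → |g a| ≤ Cg)
    (hΨb : ∀ p, |Ψ p| ≤ CΨ) (hΨ0 : ∀ n v w : V3, 2 * L ≤ ‖w - v‖ → Ψ (n, v, w) = 0) (ϑ : ℝ) :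
    |Literature.MathematicalPhysics.KineticTheory.collisionSum σ N Φ τ χ g Ψ r z -
        ∫ t in Icc 0 τ, tubeStat σ N χ g Ψ r ϑ 1 κ t (Φ.flow t z)| ≤
      ((N + 1 : ℝ) * κ)⁻¹ * collisionMismatch σ N Φ τ χ g Ψ r κ z +
        Cχ * Cg * CΨ * (hsDiameter σ N / (N + 1 : ℝ)) *
          (2 * threeBodyCollisionSum σ N Φ τ L κ z + pairShellCount σ N L κ (Φ.flow τ z)) := by
  have hε : 0 < hsDiameter σ N := hsDiameter_pos hσ N
  have hεκ : 0 ≤ κ * hsDiameter σ N := mul_nonneg hκ.le hε.le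
  obtain ⟨hCχ, hCg, hCΨ⟩ := consts_nonneg hτ.le hχb hgb hΨb
  have hN : (0 : ℝ) < N + 1 := by exact_mod_cast Nat.succ_pos N
  have hc : 0 < ((N + 1 : ℝ) * κ)⁻¹ := inv_pos.2 (mul_pos hN hκ)
  have hε2 : hsDiameter σ N < 2⁻¹ := by nlinarith [mul_nonneg hL hκ.le]
  have hfin : (collisionTimes (Torus.geometry (Fin 3)) (hsDiameter σ N) (orbit σ N Φ z) ∩ Icc 0 τ).Finite :=
    (isTraj hz).locFinite 0 τ
  have hfin' : (collisionTimes (Torus.geometry (Fin 3)) (hsDiameter σ N) (orbit σ N Φ z) ∩ Ioc 0 τ).Finite :=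
    (isTraj hz).finite_collisionTimes_inter_of_subset_Icc (S := Ioc 0 τ) Ioc_subset_Icc_self
  -- the collision side as a double sum over ordered pairs
  have hK : Literature.MathematicalPhysics.KineticTheory.collisionSum σ N Φ τ χ g Ψ r z =
      ((N + 1 : ℝ) * κ)⁻¹ * ∑ i : Fin (N + 1), ∑ j : Fin (N + 1),
        (κ * hsDiameter σ N * ∑ s ∈ hfin.toFinset,
          if (i, j) ∈ contactPairs (Torus.geometry (Fin 3)) (hsDiameter σ N) (orbit σ N Φ z s) then
            weightAt σ N χ g r s (orbit σ N Φ z s) i * collMark σ N Ψ (orbit σ N Φ z s) i j else 0) := by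
    rw [collisionSum_eq_collisionPairSum σ N χ g Ψ r Φ τ z (orbit_mem hz), collisionPairSum_eq_finset_sum hfin]
    simp_rw [sum_contactPairs_eq_sum_sum_ite]
    simp_rw [Finset.sum_comm (s := hfin.toFinset) (t := (Finset.univ : Finset (Fin (N + 1))))]
    simp_rw [← Finset.mul_sum]
    rw [← mul_assoc]
    congr 1
    field_simp
  -- the tube side
  have hA := setIntegral_tubeStat_orbit_eq (κ := κ) (τ := τ) hz hχ hg hΨc hχb hgb hΨb hσ.le hr ϑ
  -- the collision mismatch as a double sum
  have hR1 : collisionMismatch σ N Φ τ χ g Ψ r κ z = ∑ i : Fin (N + 1), ∑ j : Fin (N + 1),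
      ∑ s ∈ hfin.toFinset,
        (if (i, j) ∈ contactPairs (Torus.geometry (Fin 3)) (hsDiameter σ N) (orbit σ N Φ z s) then
          |collMark σ N Ψ (orbit σ N Φ z s) i j| *
            |κ * hsDiameter σ N * weightAt σ N χ g r s (orbit σ N Φ z s) i -
              ∫ t in Ioo (pairFlightStart σ N Φ z i j s) s ∩ Ici (s - κ * hsDiameter σ N),
                weightAt σ N χ g r t (orbit σ N Φ z t) i|
        else 0) := by
    unfold collisionMismatch
    rw [collisionPairSum_eq_finset_sum hfin]
    simp_rw [sum_contactPairs_eq_sum_sum_ite]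
    simp_rw [Finset.sum_comm (s := hfin.toFinset) (t := (Finset.univ : Finset (Fin (N + 1))))]
  -- the three-body sum
  have hN3 : ∑ i : Fin (N + 1), ∑ j : Fin (N + 1), ∑ b ∈ hfin'.toFinset,
      (if Participates (Torus.geometry (Fin 3)) (hsDiameter σ N) (orbit σ N Φ z b) i ∨
          Participates (Torus.geometry (Fin 3)) (hsDiameter σ N) (orbit σ N Φ z b) j then
        shellInd σ N L κ (orbit σ N Φ z b) i j else 0) ≤ 2 * threeBodyCollisionSum σ N Φ τ L κ z := by
    unfold threeBodyCollisionSum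
    rw [collisionPairSum_eq_finset_sum hfin', Finset.mul_sum]
    simp_rw [Finset.sum_comm (s := (Finset.univ : Finset (Fin (N + 1)))) (t := hfin'.toFinset)]
    refine Finset.sum_le_sum fun b hb => ?_
    exact sum_sum_ite_participates_le hz hε2 ((Set.Finite.mem_toFinset hfin').1 hb).1
  -- the late pairs
  have hP : ∑ i : Fin (N + 1), ∑ j : Fin (N + 1), shellInd σ N L κ (orbit σ N Φ z τ) i j =
      pairShellCount σ N L κ (Φ.flow τ z) := rfl
  -- assemble
  rw [hK, hA, ← mul_sub, ← Finset.sum_sub_distrib, abs_mul, abs_of_pos hc]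
  simp_rw [← Finset.sum_sub_distrib]
  have hpairs := fun i j => pair_pullback_le (κ := κ) hz hσ hκ hL hsmall hτ hr hχ hg hΨc hχb hgb hΨb hΨ0 i j
  calc ((N + 1 : ℝ) * κ)⁻¹ * |∑ i, ∑ j, (κ * hsDiameter σ N * ∑ s ∈ hfin.toFinset,
          (if (i, j) ∈ contactPairs (Torus.geometry (Fin 3)) (hsDiameter σ N) (orbit σ N Φ z s) then
            weightAt σ N χ g r s (orbit σ N Φ z s) i * collMark σ N Ψ (orbit σ N Φ z s) i j else 0) -
          ∫ t in Icc 0 τ, tubeTerm σ N χ g Ψ r κ t (orbit σ N Φ z t) i j)|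
      ≤ ((N + 1 : ℝ) * κ)⁻¹ * ∑ i, ∑ j, |κ * hsDiameter σ N * ∑ s ∈ hfin.toFinset,
          (if (i, j) ∈ contactPairs (Torus.geometry (Fin 3)) (hsDiameter σ N) (orbit σ N Φ z s) then
            weightAt σ N χ g r s (orbit σ N Φ z s) i * collMark σ N Ψ (orbit σ N Φ z s) i j else 0) -
          ∫ t in Icc 0 τ, tubeTerm σ N χ g Ψ r κ t (orbit σ N Φ z t) i j| := by
        refine mul_le_mul_of_nonneg_left ?_ hc.le
        exact (Finset.abs_sum_le_sum_abs _ _).trans (Finset.sum_le_sum fun i _ => Finset.abs_sum_le_sum_abs _ _)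
    _ ≤ ((N + 1 : ℝ) * κ)⁻¹ * ∑ i, ∑ j,
        ((∑ s ∈ hfin.toFinset,
            if (i, j) ∈ contactPairs (Torus.geometry (Fin 3)) (hsDiameter σ N) (orbit σ N Φ z s) then
              |collMark σ N Ψ (orbit σ N Φ z s) i j| *
                |κ * hsDiameter σ N * weightAt σ N χ g r s (orbit σ N Φ z s) i -
                  ∫ t in Ioo (pairFlightStart σ N Φ z i j s) s ∩ Ici (s - κ * hsDiameter σ N),
                    weightAt σ N χ g r t (orbit σ N Φ z t) i|
            else 0) +
          Cχ * Cg * CΨ * (κ * hsDiameter σ N) *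
            ((∑ b ∈ hfin'.toFinset,
                if Participates (Torus.geometry (Fin 3)) (hsDiameter σ N) (orbit σ N Φ z b) i ∨
                    Participates (Torus.geometry (Fin 3)) (hsDiameter σ N) (orbit σ N Φ z b) j then
                  shellInd σ N L κ (orbit σ N Φ z b) i j else 0) +
              shellInd σ N L κ (orbit σ N Φ z τ) i j)) := by
        refine mul_le_mul_of_nonneg_left ?_ hc.le
        exact Finset.sum_le_sum fun i _ => Finset.sum_le_sum fun j _ => hpairs i j
    _ = ((N + 1 : ℝ) * κ)⁻¹ * collisionMismatch σ N Φ τ χ g Ψ r κ z +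
        Cχ * Cg * CΨ * (hsDiameter σ N / (N + 1 : ℝ)) *
          ((∑ i : Fin (N + 1), ∑ j : Fin (N + 1), ∑ b ∈ hfin'.toFinset,
              (if Participates (Torus.geometry (Fin 3)) (hsDiameter σ N) (orbit σ N Φ z b) i ∨
                  Participates (Torus.geometry (Fin 3)) (hsDiameter σ N) (orbit σ N Φ z b) j then
                shellInd σ N L κ (orbit σ N Φ z b) i j else 0)) +
            ∑ i : Fin (N + 1), ∑ j : Fin (N + 1), shellInd σ N L κ (orbit σ N Φ z τ) i j) := by
        rw [hR1]
        simp only [Finset.sum_add_distrib, mul_add, ← Finset.mul_sum]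
        have hcoef : ((N + 1 : ℝ) * κ)⁻¹ * (Cχ * Cg * CΨ * (κ * hsDiameter σ N)) =
            Cχ * Cg * CΨ * (hsDiameter σ N / (N + 1 : ℝ)) := by
          field_simp
        rw [← hcoef]
        ring
    _ ≤ ((N + 1 : ℝ) * κ)⁻¹ * collisionMismatch σ N Φ τ χ g Ψ r κ z +
        Cχ * Cg * CΨ * (hsDiameter σ N / (N + 1 : ℝ)) *
          (2 * threeBodyCollisionSum σ N Φ τ L κ z + pairShellCount σ N L κ (Φ.flow τ z)) := by
        rw [hP]
        have hcoef : 0 ≤ Cχ * Cg * CΨ * (hsDiameter σ N / (N + 1 : ℝ)) := by positivity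
        nlinarith [mul_le_mul_of_nonneg_left hN3 hcoef]

end Assembly

end Literature.MathematicalPhysics.KineticTheory

end
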